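import Summits.AtomisticToContinuum.HydrodynamicLimit.Theorems.StiffCollisionalRelaxationAssemblyFields

/-!
# Macroscopic bookkeeping for the hydrodynamic-limit assembly — IV: identification of the Euler data

Helper file for item stmt-AtomisticToContinuum-11094 (`StiffCollisionalRelaxation.Assembly`).
`HydrodynamicLimit` quantifies over every classical hs-Euler solution `(ρ, u, θ)` whose time-`0`
fields are the limit in probability of the empirical fields (`TendstoHydroFieldsAt … 0`), while the
statics input `MesoscopicLLN` produces the limit profile `(ρ₀, ρ₀u₀, E₀)` of the BLOCK fields in
`L²ₓ`. The assembly needs `(ρ, u, θ)(0) = (ρ₀, u₀, θ₀)`; this file proves it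
(`identify_initial_data`): block fields `L²ₓ`-close to the profile are, tested against a continuous
`χ`, close to `∫χρ₀` (commutator estimate of part I + an AM–GM absorption of the `L¹ₓ` error into
the `L²ₓ` event, with the velocity moments controlled on the same event through
`∫Ē dx = ⟨μ, ‖v‖²/2⟩`), limits in probability under probability laws are unique, and continuous
profiles with equal pairings coincide.
-/

namespace Summit.AtomisticToContinuum.HydrodynamicLimit.Theorems.MacroBookkeeping

open MeasureTheory Filter Topology Set
open Literature.MathematicalPhysics.KineticTheory
open Literature.Analysis.FluidPDE (Config HardSphereFlow empiricalMeasure integral_empiricalMeasure)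
open Literature.Analysis.FluidPDE.Torus (euclidDist)
open scoped ENNReal

noncomputable section

/-! ### Uniform continuity in the minimal-image distance; bounds; AM–GM absorption -/

/-- A continuous function on `𝕋³` has an `η`-modulus in the minimal-image distance. -/
theorem exists_modulus_euclidDist {χ : T3 → ℝ} (hχ : Continuous χ) {η : ℝ} (hη : 0 < η) :
    ∃ r : ℝ, 0 < r ∧ ∀ x y, euclidDist y x < r → |χ y - χ x| ≤ η := by
  have hu : UniformContinuous χ := CompactSpace.uniformContinuous_of_continuous hχ
  obtain ⟨r, hr, hrf⟩ := Metric.uniformContinuous_iff.1 hu η hη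
  refine ⟨r, hr, fun x y hxy => ?_⟩
  have hd : dist y x < r := by
    rw [dist_eq_norm]
    exact (Literature.Analysis.FluidPDE.Torus.norm_sub_le_euclidDist_holds y x).trans_lt hxy
  have h := hrf hd
  rw [Real.dist_eq] at h
  exact h.le

/-- A continuous function on `𝕋³` is bounded by a positive constant. -/
theorem exists_pos_forall_abs_le {χ : T3 → ℝ} (hχ : Continuous χ) :
    ∃ B : ℝ, 0 < B ∧ ∀ x, |χ x| ≤ B := by
  obtain ⟨C, hC⟩ := isCompact_univ.exists_bound_of_continuousOn hχ.continuousOn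
  refine ⟨max C 1, lt_max_of_lt_right one_pos, fun x => ?_⟩
  have h := hC x (mem_univ x)
  rw [Real.norm_eq_abs] at h
  exact h.trans (le_max_left _ _)

/-- **AM–GM absorption** (scalar): `∫ |f| ≤ ε/2 + (2ε)⁻¹ ∫ f²` for continuous `f` and `ε > 0`. -/
theorem integral_abs_le_of_sq {f : T3 → ℝ} (hf : Continuous f) {ε : ℝ} (hε : 0 < ε) :
    ∫ x, |f x| ≤ ε / 2 + (2 * ε)⁻¹ * ∫ x, f x ^ 2 := by
  have hε2 : 0 < 2 * ε := by positivity
  have hpt : ∀ x, |f x| ≤ ε / 2 + (2 * ε)⁻¹ * f x ^ 2 := fun x => by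
    have key : 2 * ε * |f x| ≤ ε ^ 2 + f x ^ 2 := by
      nlinarith [sq_nonneg (|f x| - ε), sq_abs (f x)]
    calc |f x| = 2 * ε * |f x| / (2 * ε) := by field_simp
      _ ≤ (ε ^ 2 + f x ^ 2) / (2 * ε) := by gcongr
      _ = ε / 2 + (2 * ε)⁻¹ * f x ^ 2 := by field_simp
  calc ∫ x, |f x| ≤ ∫ x, (ε / 2 + (2 * ε)⁻¹ * f x ^ 2) :=
        integral_mono (integrable_T3' hf.abs) (integrable_T3' (by fun_prop)) hpt
    _ = ε / 2 + (2 * ε)⁻¹ * ∫ x, f x ^ 2 := by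
        rw [integral_add (integrable_const _) (integrable_T3' (by fun_prop)), integral_const_mul]
        simp

/-- **AM–GM absorption** (vector): `∫ ‖g‖ ≤ ε/2 + (2ε)⁻¹ ∫ ‖g‖²`. -/
theorem integral_norm_le_of_sq {g : T3 → V3} (hg : Continuous g) {ε : ℝ} (hε : 0 < ε) :
    ∫ x, ‖g x‖ ≤ ε / 2 + (2 * ε)⁻¹ * ∫ x, ‖g x‖ ^ 2 := by
  have h := integral_abs_le_of_sq hg.norm hε
  simpa only [abs_norm] using h

/-! ### Deterministic estimates for one configuration -/

section OneConfig

variable {N : ℕ} (z : Config (N + 1) (Fin 3) T3) {φ χ : T3 → ℝ} {r η B : ℝ}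

/-- Velocity first moment against the second: `⟨μ_z, ‖v‖⟩ ≤ 1/2 + ⟨μ_z, ‖v‖²/2⟩`. -/
theorem integral_norm_vel_le :
    ∫ y, ‖y.2‖ ∂empiricalMeasure z ≤ 1 / 2 + ∫ y, ‖y.2‖ ^ 2 / 2 ∂empiricalMeasure z := by
  rw [integral_empiricalMeasure, integral_empiricalMeasure]
  have hpt : ∀ i : Fin (N + 1), ‖(z i).2‖ ≤ 1 / 2 + ‖(z i).2‖ ^ 2 / 2 := fun i => by
    nlinarith [sq_nonneg (‖(z i).2‖ - 1), norm_nonneg (z i).2]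
  have hN : (0 : ℝ) < ((N + 1 : ℕ) : ℝ) := by positivity
  calc ((N + 1 : ℕ) : ℝ)⁻¹ * ∑ i, ‖(z i).2‖
      ≤ ((N + 1 : ℕ) : ℝ)⁻¹ * ∑ i : Fin (N + 1), (1 / 2 + ‖(z i).2‖ ^ 2 / 2) :=
        mul_le_mul_of_nonneg_left (Finset.sum_le_sum fun i _ => hpt i) (by positivity)
    _ = 1 / 2 + ((N + 1 : ℕ) : ℝ)⁻¹ * ∑ i, ‖(z i).2‖ ^ 2 / 2 := by
        rw [Finset.sum_add_distrib, Finset.sum_const, Finset.card_univ, Fintype.card_fin,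
          nsmul_eq_mul, mul_add, ← mul_assoc, inv_mul_cancel₀ hN.ne', one_mul]

/-- Density: `|⟨μ_z, χ⟩ − ∫χρ₀| ≤ η + B ∫|ρ̄_z − ρ₀|`. -/
theorem abs_densityField_sub_integral_le (hφc : Continuous φ) (hφ0 : ∀ y, 0 ≤ φ y)
    (hφ1 : ∫ y, φ y = 1) (hsupp : ∀ y, r ≤ euclidDist y 0 → φ y = 0) (hχ : Continuous χ)
    (hmod : ∀ x y, euclidDist y x < r → |χ y - χ x| ≤ η) (hB : ∀ x, |χ x| ≤ B)
    {ρ₀ : T3 → ℝ} (hρ₀ : Continuous ρ₀) :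
    |empiricalDensityField z χ - ∫ x, χ x * ρ₀ x| ≤
      η + B * ∫ x, |empiricalDensityField z (fun y => φ (y - x)) - ρ₀ x| := by
  have h1 := abs_densityField_sub_le (Nat.succ_ne_zero N) z hφc hφ0 hφ1 hsupp hχ hmod
  have hcont := continuous_blockDensity z hφc
  have hi1 : Integrable fun x => χ x * empiricalDensityField z (fun y => φ (y - x)) :=
    integrable_T3' (hχ.mul hcont)
  have hi2 : Integrable fun x => χ x * ρ₀ x := integrable_T3' (hχ.mul hρ₀)
  have h2 : |(∫ x, χ x * empiricalDensityField z (fun y => φ (y - x))) - ∫ x, χ x * ρ₀ x| ≤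
      B * ∫ x, |empiricalDensityField z (fun y => φ (y - x)) - ρ₀ x| := by
    rw [← integral_sub hi1 hi2, ← integral_const_mul]
    refine (abs_integral_le_integral_abs).trans (integral_mono (hi1.sub hi2).abs
      (integrable_T3' (by fun_prop)) fun x => ?_)
    dsimp only
    rw [← mul_sub, abs_mul]
    exact mul_le_mul_of_nonneg_right (hB x) (abs_nonneg _)
  calc |empiricalDensityField z χ - ∫ x, χ x * ρ₀ x|
      ≤ |empiricalDensityField z χ - ∫ x, χ x * empiricalDensityField z (fun y => φ (y - x))| +
        |(∫ x, χ x * empiricalDensityField z (fun y => φ (y - x))) - ∫ x, χ x * ρ₀ x| :=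
        abs_sub_le _ _ _
    _ ≤ _ := add_le_add h1 h2

/-- Momentum: `‖⟨μ_z, χ v⟩ − ∫(χρ₀)u₀‖ ≤ η ⟨μ_z, ‖v‖⟩ + B ∫‖m̄_z − ρ₀u₀‖`. -/
theorem norm_momentumField_sub_integral_le (hφc : Continuous φ) (hφ0 : ∀ y, 0 ≤ φ y)
    (hφ1 : ∫ y, φ y = 1) (hsupp : ∀ y, r ≤ euclidDist y 0 → φ y = 0) (hχ : Continuous χ)
    (hmod : ∀ x y, euclidDist y x < r → |χ y - χ x| ≤ η) (hB : ∀ x, |χ x| ≤ B)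
    {ρ₀ : T3 → ℝ} {u₀ : T3 → V3} (hρ₀ : Continuous ρ₀) (hu₀ : Continuous u₀) :
    ‖empiricalMomentumField z χ - ∫ x, (χ x * ρ₀ x) • u₀ x‖ ≤
      η * ∫ y, ‖y.2‖ ∂empiricalMeasure z +
        B * ∫ x, ‖empiricalMomentumField z (fun y => φ (y - x)) - ρ₀ x • u₀ x‖ := by
  have h1 := norm_momentumField_sub_le z hφc hφ0 hφ1 hsupp hχ hmod
  have hcont := continuous_blockMomentum z hφc
  have hi1 : Integrable fun x => χ x • empiricalMomentumField z (fun y => φ (y - x)) :=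
    integrable_T3' (hχ.smul hcont)
  have hi2 : Integrable fun x => (χ x * ρ₀ x) • u₀ x := integrable_T3' ((hχ.mul hρ₀).smul hu₀)
  have h2 : ‖(∫ x, χ x • empiricalMomentumField z (fun y => φ (y - x))) - ∫ x, (χ x * ρ₀ x) • u₀ x‖
      ≤ B * ∫ x, ‖empiricalMomentumField z (fun y => φ (y - x)) - ρ₀ x • u₀ x‖ := by
    rw [← integral_sub hi1 hi2, ← integral_const_mul]
    refine (norm_integral_le_integral_norm _).trans (integral_mono (hi1.sub hi2).norm
      (integrable_T3' (by fun_prop)) fun x => ?_)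
    dsimp only
    rw [← smul_smul, ← smul_sub, norm_smul, Real.norm_eq_abs]
    exact mul_le_mul_of_nonneg_right (hB x) (norm_nonneg _)
  calc ‖empiricalMomentumField z χ - ∫ x, (χ x * ρ₀ x) • u₀ x‖
      ≤ ‖empiricalMomentumField z χ - ∫ x, χ x • empiricalMomentumField z (fun y => φ (y - x))‖ +
        ‖(∫ x, χ x • empiricalMomentumField z (fun y => φ (y - x))) - ∫ x, (χ x * ρ₀ x) • u₀ x‖ :=
        norm_sub_le_norm_sub_add_norm_sub _ _ _
    _ ≤ _ := add_le_add h1 h2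

/-- Energy: `|⟨μ_z, χ‖v‖²/2⟩ − ∫χE₀| ≤ η ⟨μ_z, ‖v‖²/2⟩ + B ∫|Ē_z − E₀|`. -/
theorem abs_energyField_sub_integral_le (hφc : Continuous φ) (hφ0 : ∀ y, 0 ≤ φ y)
    (hφ1 : ∫ y, φ y = 1) (hsupp : ∀ y, r ≤ euclidDist y 0 → φ y = 0) (hχ : Continuous χ)
    (hmod : ∀ x y, euclidDist y x < r → |χ y - χ x| ≤ η) (hB : ∀ x, |χ x| ≤ B)
    {E₀ : T3 → ℝ} (hE₀ : Continuous E₀) :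
    |empiricalEnergyField z χ - ∫ x, χ x * E₀ x| ≤
      η * ∫ y, ‖y.2‖ ^ 2 / 2 ∂empiricalMeasure z +
        B * ∫ x, |empiricalEnergyField z (fun y => φ (y - x)) - E₀ x| := by
  have h1 := abs_energyField_sub_le z hφc hφ0 hφ1 hsupp hχ hmod
  have hcont := continuous_blockEnergy z hφc
  have hi1 : Integrable fun x => χ x * empiricalEnergyField z (fun y => φ (y - x)) :=
    integrable_T3' (hχ.mul hcont)
  have hi2 : Integrable fun x => χ x * E₀ x := integrable_T3' (hχ.mul hE₀)
  have h2 : |(∫ x, χ x * empiricalEnergyField z (fun y => φ (y - x))) - ∫ x, χ x * E₀ x| ≤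
      B * ∫ x, |empiricalEnergyField z (fun y => φ (y - x)) - E₀ x| := by
    rw [← integral_sub hi1 hi2, ← integral_const_mul]
    refine (abs_integral_le_integral_abs).trans (integral_mono (hi1.sub hi2).abs
      (integrable_T3' (by fun_prop)) fun x => ?_)
    dsimp only
    rw [← mul_sub, abs_mul]
    exact mul_le_mul_of_nonneg_right (hB x) (abs_nonneg _)
  calc |empiricalEnergyField z χ - ∫ x, χ x * E₀ x|
      ≤ |empiricalEnergyField z χ - ∫ x, χ x * empiricalEnergyField z (fun y => φ (y - x))| +
        |(∫ x, χ x * empiricalEnergyField z (fun y => φ (y - x))) - ∫ x, χ x * E₀ x| :=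
        abs_sub_le _ _ _
    _ ≤ _ := add_le_add h1 h2

end OneConfig

end

end Summit.AtomisticToContinuum.HydrodynamicLimit.Theorems.MacroBookkeeping
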